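import Mathlib.RingTheory.SimpleModule.Basic
import Mathlib.LinearAlgebra.PiTensorProduct.Basis
import Mathlib.LinearAlgebra.Eigenspace.Triangularizable
import Literature.NumberTheory.Automorphic.RestrictedTensorProductProofs
import HarnessLib

/-!
# Irreducibility of restricted tensor products (Flath's theorem, easy direction) — proofs

Topic `NumberTheory/Automorphic`; proof file (theorems only, no definition, no named fact) for
`Literature/NumberTheory/Automorphic/RestrictedTensorProduct.lean`, kept separate from the
siblings `RestrictedTensorProductProofs.lean` (universal property, uniqueness, independence of the
base vectors — whose lemmas on the ranges of the structure maps `liftFinset S` are reused here) and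
`RestrictedTensorProductSmoothProofs.lean` (smoothness). It discharges the named fact
`Literature.NumberTheory.Automorphic.IsRestrictedTensorProductRep.isIrreducible` of the statement file:

* `IsRestrictedTensorProductRep.isIrreducible_holds`: over an algebraically closed field, a
  restricted tensor product `(W, π, j)` of irreducible admissible representations `ρ i` of locally
  profinite groups `G i` (with respect to compact open `K i`) is an irreducible representation of
  the restricted product group `Πʳ i, [G i, K i]`
  (Flath, Corvallis 1979, Theorem 2 with Example 2; Bump 1997, Prop. 3.4.9 and Thm. 3.4.4),

so that users of the fact `(h : IsRestrictedTensorProductRep.isIrreducible)` can be fed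
`isIrreducible_holds`.

## The argument

The printed proofs (Flath §§1–2; Bump §3.4, pp. 301–314) pass through Hecke algebras: `V` is
irreducible admissible iff every `V^K` is a simple finite-dimensional `H(G//K)`-module, and
`M ⊗ N` is simple over `A ⊗ B` by Burnside's theorem (Bump, Thm. 3.4.1, Prop. 3.4.2, Thm. 3.4.2).
For the direction proved here the Hecke algebra can be short-circuited by the same two algebraic
inputs, Schur and Burnside/Jacobson density, applied to the group algebras directly:

1. `Representation.IsAdmissible.exists_eq_smul_id` (**Schur's lemma for admissible
   representations**, Bump, Prop. 4.2.4; Bernstein–Zelevinsky 1976, 2.11): an intertwiner `T` of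
   an irreducible admissible `ρ` over an algebraically closed field is scalar — `T` preserves the
   finite-dimensional non-zero `V^{K ∩ Stab v}`, so has an eigenvalue `c` there, and `ker (T - c)`
   is a non-zero subrepresentation.
2. `Representation.exists_asAlgebraHom_apply_eq` (**Jacobson density**, Hungerford Thm. IX.1.12;
   Mathlib `jacobson_density`): if `ρ` is irreducible with scalar commutant then `k[G]` interpolates every
   `k`-linear map on every finite subset of `V`.
3. `piTensorProduct_submodule_eq_top` (**finite tensor products**, Bump Prop. 3.4.9 / Flath Thm. 1,
   irreducibility part): if each `k[G i] → End (V i)` is dense in the sense of 2, a non-zero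
   subspace `U ≤ ⨂ i, V i` stable under all `⊗ i, ρ i (g i)` is everything — expand `u ≠ 0` in the
   tensor basis (Mathlib `Basis.piTensorProduct`), pick a non-zero coordinate `p`, and realise the
   rank-one maps `v ↦ p_i^*(v) • y i` on the finitely many basis vectors involved by group-algebra
   elements; their tensor product sends `u` to a non-zero multiple of `⊗ i, y i`.
4. `IsRestrictedTensorProductRep.isIrreducible_holds` (**the direct limit**): `W` is the directed
   union of the ranges `W_S` of the structure maps `liftFinset S : ⨂_{i ∈ S} V i → W`
   (`IsRestrictedMultilinear.monotone_range_liftFinset`, from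
   `IsRestrictedMultilinear.range_liftFinset_mono` of the sibling proof file), and `liftFinset S`
   intertwines `⊗_{i ∈ S} ρ i (g i)` with `π` of the element `g` extended by `1` off `S`
   (`IsRestrictedMultilinear.liftFinset_map_eq`); so the preimage of a non-zero subrepresentation
   `U` in `⨂_{i ∈ S} V i` is stable and non-zero for `S` large, hence everything by 3, whence
   `W_S ≤ U` for all large `S` and `U = W`. Non-triviality of `W`: `liftFinset S₀` is injective on
   the non-zero `⨂_{i ∈ S₀} V i` (`piTensorProduct_nontrivial`).

As in the source, the spherical hypothesis (`hsph`) of the named fact is only needed for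
*admissibility* of the restricted tensor product, not for its irreducibility; the fact is proved
exactly as stated.

## References

* D. Flath, *Decomposition of representations into tensor products*, Proc. Sympos. Pure Math. 33
  (Corvallis 1979), part 1, 179–183: Theorem 1, Theorem 2, Example 2 [FlathCorvallis1979]
  (= [Flath1979] of the statement file).
* D. Bump, *Automorphic forms and representations*, Cambridge Stud. Adv. Math. 55 (1997), §3.4:
  Thm. 3.4.1 (Burnside), Prop. 3.4.2, Thm. 3.4.2, Prop. 3.4.9, Thm. 3.4.4; §4.2: Prop. 4.2.4
  (Schur's lemma for irreducible admissible representations of totally disconnected locally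
  compact groups) [Bump1997].
* I. N. Bernstein, A. V. Zelevinsky, *Representations of the group `GL(n, F)` where `F` is a
  non-archimedean local field*, Russian Math. Surveys 31 (1976), 2.11 (Schur's lemma)
  [BernsteinZelevinskyRMS1976].
* T. W. Hungerford, *Algebra*, GTM 73 (1974), Thm. IX.1.12 (Jacobson density theorem), p. 420
  [Hungerford1974].
-/

open Module
open scoped RestrictedProduct TensorProduct
open Filter PiTensorProduct

/-! ### Schur's lemma and Jacobson density for a single representation -/

namespace Representation

variable {k G V : Type*} [Field k] [Group G] [AddCommGroup V] [Module k V]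

/-- An irreducible representation lives on a non-trivial module (`⊥ ≠ ⊤` among its
subrepresentations). Deliberate dot-notation extension of Mathlib's `Representation` namespace. [folklore] -/
theorem IsIrreducible.nontrivial (ρ : Representation k G V) [ρ.IsIrreducible] : Nontrivial V := by
  by_contra hV
  rw [not_nontrivial_iff_subsingleton] at hV
  have : (⊥ : Subrepresentation ρ) = ⊤ :=
    Subrepresentation.toSubmodule_injective (Subsingleton.elim _ _)
  exact (IsSimpleOrder.bot_ne_top (α := Subrepresentation ρ)) this

/-- Membership in the bottom subrepresentation (deliberate extension of Mathlib's `Subrepresentation`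
namespace, which lacks this unfolding lemma). [folklore] -/
theorem _root_.Subrepresentation.mem_bot_iff {ρ : Representation k G V} (v : V) :
    v ∈ (⊥ : Subrepresentation ρ) ↔ v = 0 :=
  Submodule.mem_bot k

/-- Every vector lies in the top subrepresentation (deliberate extension of Mathlib's
`Subrepresentation` namespace; primed to stay clear of a future Mathlib `mem_top`). [folklore] -/
theorem _root_.Subrepresentation.mem_top' {ρ : Representation k G V} (v : V) :
    v ∈ (⊤ : Subrepresentation ρ) :=
  Submodule.mem_top

/-- **Jacobson density for an irreducible representation with scalar commutant.** If `ρ` is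
irreducible and every intertwiner `V → V` is a scalar, then for every finite set `s ⊆ V` and every
`k`-linear `f : V → V` there is an element `r` of the group algebra `k[G]` acting as `f` on `s`.
This is Mathlib's bicommutant form `jacobson_density` (every `End_{k[G]}(V)`-linear map is
interpolated by `k[G]` on finite sets) combined with `End_{k[G]}(V) = k`.
(Jacobson density theorem, Hungerford, *Algebra*, Thm. IX.1.12, p. 420; Bump 1997, Thm. 3.4.1
(Burnside) is the finite-dimensional case.) [cite: Hungerford1974, Theorem IX.1.12] -/
theorem exists_asAlgebraHom_apply_eq {ρ : Representation k G V} [ρ.IsIrreducible]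
    (hs : ∀ T : V →ₗ[k] V, (∀ g : G, T ∘ₗ ρ g = ρ g ∘ₗ T) → ∃ c : k, T = c • LinearMap.id)
    (s : Finset V) (f : V →ₗ[k] V) :
    ∃ r : MonoidAlgebra k G, ∀ m ∈ s, ρ.asAlgebraHom r m = f m := by
  have hsc : ∀ e : Module.End (MonoidAlgebra k G) ρ.asModule, ∃ c : k, ∀ m, e m = c • m := by
    intro e
    let T : V →ₗ[k] V :=
      ρ.asModuleEquiv.toLinearMap ∘ₗ e.restrictScalars k ∘ₗ ρ.asModuleEquiv.symm.toLinearMap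
    obtain ⟨c, hc⟩ := hs T fun g => by
      ext v
      change ρ.asModuleEquiv (e (ρ.asModuleEquiv.symm (ρ g v))) =
        ρ g (ρ.asModuleEquiv (e (ρ.asModuleEquiv.symm v)))
      rw [asModuleEquiv_symm_map_rho, map_smul, asModuleEquiv_map_smul, asAlgebraHom_of]
    exact ⟨c, fun m => congr($hc (ρ.asModuleEquiv m))⟩
  let f' : Module.End (Module.End (MonoidAlgebra k G) ρ.asModule) ρ.asModule :=
    { toFun := fun m => ρ.asModuleEquiv.symm (f (ρ.asModuleEquiv m))
      map_add' := fun x y => by simp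
      map_smul' := fun e m => by
        obtain ⟨c, hc⟩ := hsc e
        change ρ.asModuleEquiv.symm (f (ρ.asModuleEquiv (e m))) =
          e (ρ.asModuleEquiv.symm (f (ρ.asModuleEquiv m)))
        rw [hc, hc, map_smul, map_smul, map_smul] }
  obtain ⟨r, hr⟩ := jacobson_density f' (s.map ρ.asModuleEquiv.symm.toEquiv.toEmbedding)
  refine ⟨r, fun m hm => ?_⟩
  have := hr (ρ.asModuleEquiv.symm m) (Finset.mem_map_of_mem _ hm)
  simpa [f'] using congrArg ρ.asModuleEquiv this.symm

variable [TopologicalSpace G]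

/-- **Schur's lemma for admissible representations.** Let `ρ` be an irreducible admissible
representation of a topological group `G` possessing a compact open subgroup `K`, over an
algebraically closed field. Then every intertwiner `T : V → V` (`T ∘ ρ g = ρ g ∘ T`) is a scalar:
for `v ≠ 0` the subgroup `K' = K ∩ Stab(v)` is compact open, so `V^{K'}` is finite-dimensional,
non-zero and `T`-stable; an eigenvalue `c` of `T` on it gives the non-zero subrepresentation
`ker (T - c)`, which is everything.
(Bump 1997, Proposition 4.2.4, stated there over `ℂ` for totally disconnected locally compact `G`;
Bernstein–Zelevinsky 1976, 2.11.) [cite: Bump1997, Proposition 4.2.4] -/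
theorem IsAdmissible.exists_eq_smul_id [IsAlgClosed k] [SeparatelyContinuousMul G]
    {ρ : Representation k G V} [ρ.IsIrreducible] (hρ : ρ.IsAdmissible)
    {K : Subgroup G} (hK : IsOpen (K : Set G)) (hKc : IsCompact (K : Set G))
    (T : V →ₗ[k] V) (hT : ∀ g : G, T ∘ₗ ρ g = ρ g ∘ₗ T) :
    ∃ c : k, T = c • LinearMap.id := by
  haveI : Nontrivial V := IsIrreducible.nontrivial ρ
  obtain ⟨v, hv⟩ := exists_ne (0 : V)
  have hT' : ∀ (g : G) (w : V), T (ρ g w) = ρ g (T w) := fun g w => congr($(hT g) w)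
  set K' : Subgroup G := K ⊓ ρ.stabilizerSubgroup v with hK'def
  have hK'open : IsOpen (K' : Set G) := hK.inter (hρ.isSmooth v)
  have hK'cpt : IsCompact (K' : Set G) :=
    hKc.of_isClosed_subset (Subgroup.isClosed_of_isOpen _ hK'open) fun g hg => hg.1
  haveI hfin : Module.Finite k (ρ.fixedPoints K') := hρ.finite_fixedPoints ⟨K', hK'open⟩ hK'cpt
  have hvK' : v ∈ ρ.fixedPoints K' := (ρ.mem_fixedPoints K' v).2 fun g hg => hg.2
  have hTK' : ∀ w ∈ ρ.fixedPoints K', T w ∈ ρ.fixedPoints K' := by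
    intro w hw
    rw [mem_fixedPoints] at hw ⊢
    intro g hg
    rw [← hT', hw g hg]
  haveI : Nontrivial (ρ.fixedPoints K') :=
    ⟨⟨⟨v, hvK'⟩, 0, fun h => hv (congrArg Subtype.val h)⟩⟩
  obtain ⟨c, hc⟩ := Module.End.exists_eigenvalue (T.restrict hTK')
  obtain ⟨w, hw⟩ := hc.exists_hasEigenvector
  have hw1 : T w = c • (w : V) := by
    simpa [LinearMap.restrict_apply] using congrArg Subtype.val hw.apply_eq_smul
  have hw0 : (w : V) ≠ 0 := fun h => hw.2 (Subtype.ext h)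
  let N : Subrepresentation ρ :=
    ⟨LinearMap.ker (T - c • LinearMap.id), fun g x hx => by
      simp only [LinearMap.mem_ker, LinearMap.sub_apply, LinearMap.smul_apply, LinearMap.id_apply,
        sub_eq_zero] at hx ⊢
      rw [hT', hx, map_smul]⟩
  have hN : N ≠ ⊥ := by
    intro h
    have hwN : (w : V) ∈ N := by
      change (w : V) ∈ LinearMap.ker (T - c • LinearMap.id)
      simp [hw1]
    rw [h, Subrepresentation.mem_bot_iff] at hwN
    exact hw0 hwN
  have hNtop : N = ⊤ := (eq_bot_or_eq_top N).resolve_left hN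
  refine ⟨c, LinearMap.ext fun x => ?_⟩
  have hx : x ∈ N := hNtop ▸ Subrepresentation.mem_top' x
  change x ∈ LinearMap.ker (T - c • LinearMap.id) at hx
  simpa [sub_eq_zero] using hx

end Representation

namespace Literature.NumberTheory.Automorphic

universe u uk uG v w

/-! ### Finite tensor products -/

section PiTensor

variable {ι : Type*} [Fintype ι] [DecidableEq ι] {k : Type*} [Field k]
  {G : ι → Type*} [∀ i, Group (G i)] {V : ι → Type*} [∀ i, AddCommGroup (V i)]
  [∀ i, Module k (V i)]

/-- Expansion of the tensor product `⊗ i, ρ i (r i)` of a family of group-algebra elements as a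
linear combination of the operators `⊗ i, ρ i (g i)`, `g` ranging over the product of the
supports (multilinearity of `PiTensorProduct.map`, Mathlib `PiTensorProduct.mapMultilinear`). [folklore] -/
theorem piTensorProduct_map_asAlgebraHom (ρ : ∀ i, Representation k (G i) (V i))
    (r : ∀ i, MonoidAlgebra k (G i)) :
    map (fun i => (ρ i).asAlgebraHom (r i)) =
      ∑ σ ∈ Fintype.piFinset fun i => (r i).coeff.support,
        (∏ i, (r i).coeff (σ i)) • map fun i => ρ i (σ i) := by
  have h : (fun i => (ρ i).asAlgebraHom (r i)) =
      fun i => ∑ g ∈ (r i).coeff.support, ((r i).coeff g) • ρ i g := by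
    funext i
    rw [Representation.asAlgebraHom_def, MonoidAlgebra.lift_apply]
    rfl
  rw [h, ← mapMultilinear_apply, MultilinearMap.map_sum_finset]
  refine Finset.sum_congr rfl fun σ _ => ?_
  rw [MultilinearMap.map_smul_univ, mapMultilinear_apply]

/-- A subspace of `⨂ i, V i` stable under the operators `⊗ i, ρ i (g i)` (`g ∈ ∏ i, G i`) is
stable under `⊗ i, ρ i (r i)` for all families `r` of group-algebra elements. [folklore] -/
theorem piTensorProduct_map_asAlgebraHom_mem (ρ : ∀ i, Representation k (G i) (V i))
    {U : Submodule k (⨂[k] i, V i)}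
    (hU : ∀ (g : ∀ i, G i), ∀ u ∈ U, map (fun i => ρ i (g i)) u ∈ U)
    (r : ∀ i, MonoidAlgebra k (G i)) {u : ⨂[k] i, V i} (hu : u ∈ U) :
    map (fun i => (ρ i).asAlgebraHom (r i)) u ∈ U := by
  rw [piTensorProduct_map_asAlgebraHom, LinearMap.sum_apply]
  exact Submodule.sum_mem _ fun σ _ => by
    rw [LinearMap.smul_apply]
    exact Submodule.smul_mem _ _ (hU σ u hu)

/-- **Irreducibility of finite tensor products (submodule form).** Let `ρ i` (`i ∈ ι`, finite) be
representations such that each group algebra `k[G i]` interpolates every `k`-linear map of `V i`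
on every finite subset (as supplied by `Representation.exists_asAlgebraHom_apply_eq` for
irreducible representations with scalar commutant). Then a non-zero subspace `U ≤ ⨂ i, V i`
stable under all `⊗ i, ρ i (g i)` is the whole space: for `u ∈ U`, `u ≠ 0`, choose a coordinate
`p` of `u` in the tensor basis with non-zero coefficient and realise the rank-one maps
`v ↦ p_i^*(v) • y i` on the finitely many basis vectors occurring in `u`; the tensor product of
the interpolating elements sends `u` to `u_p • ⊗ i, y i ∈ U`, so every pure tensor lies in `U`.
(Bump 1997, Prop. 3.4.2 and Prop. 3.4.9, irreducibility part; cf. Flath 1979, Theorem 1.) [cite: Bump1997, Proposition 3.4.9] -/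
theorem piTensorProduct_submodule_eq_top (ρ : ∀ i, Representation k (G i) (V i))
    (hd : ∀ i (s : Finset (V i)) (f : V i →ₗ[k] V i),
      ∃ r : MonoidAlgebra k (G i), ∀ m ∈ s, (ρ i).asAlgebraHom r m = f m)
    {U : Submodule k (⨂[k] i, V i)}
    (hU : ∀ (g : ∀ i, G i), ∀ u ∈ U, map (fun i => ρ i (g i)) u ∈ U) (hU0 : U ≠ ⊥) :
    U = ⊤ := by
  classical
  obtain ⟨u, huU, hu0⟩ := Submodule.exists_mem_ne_zero_of_ne_bot hU0
  let b : ∀ i, Basis (Free.ChooseBasisIndex k (V i)) k (V i) := fun i => Free.chooseBasis k (V i)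
  let B := Basis.piTensorProduct b
  obtain ⟨p, hp⟩ : ∃ p, B.repr u p ≠ 0 := by
    by_contra! h
    exact hu0 (B.repr.injective (by ext q; simp [h q]))
  rw [eq_top_iff, ← span_tprod_eq_top, Submodule.span_le]
  rintro _ ⟨y, rfl⟩
  let f : ∀ i, V i →ₗ[k] V i := fun i => ((b i).coord (p i)).smulRight (y i)
  let s : ∀ i, Finset (V i) := fun i => (B.repr u).support.image fun q => b i (q i)
  choose r hr using fun i => hd i (s i) (f i)
  have h1 : map (fun i => (ρ i).asAlgebraHom (r i)) u ∈ U :=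
    piTensorProduct_map_asAlgebraHom_mem ρ hU r huU
  have h2 : map (fun i => (ρ i).asAlgebraHom (r i)) u = map f u := by
    conv_lhs => rw [← B.linearCombination_repr u]
    conv_rhs => rw [← B.linearCombination_repr u]
    rw [Finsupp.linearCombination_apply, Finsupp.sum, map_sum, map_sum]
    refine Finset.sum_congr rfl fun q hq => ?_
    rw [map_smul, map_smul]
    congr 1
    rw [Basis.piTensorProduct_apply, map_tprod, map_tprod]
    congr 1
    funext i
    exact hr i _ (Finset.mem_image_of_mem _ hq)
  have h3 : map f u = B.repr u p • PiTensorProduct.tprod k y := by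
    have : map f = (B.coord p).smulRight (PiTensorProduct.tprod k y) := by
      refine PiTensorProduct.ext (MultilinearMap.ext fun x => ?_)
      simp only [LinearMap.compMultilinearMap_apply, map_tprod, LinearMap.smulRight_apply,
        Basis.coord_apply, B, Basis.piTensorProduct_repr_tprod_apply, f]
      exact (PiTensorProduct.tprod k).map_smul_univ _ _
    rw [this]
    rfl
  have h4 : B.repr u p • PiTensorProduct.tprod k y ∈ U := by
    rw [← h3, ← h2]
    exact h1
  have := U.smul_mem (B.repr u p)⁻¹ h4
  rwa [smul_smul, inv_mul_cancel₀ hp, one_smul] at this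

omit [DecidableEq ι] in
/-- A finite tensor product of non-zero vector spaces is non-zero (the tensor basis is indexed by
a non-empty type). [folklore] -/
theorem piTensorProduct_nontrivial [∀ i, Nontrivial (V i)] : Nontrivial (⨂[k] i, V i) := by
  let b : ∀ i, Basis (Free.ChooseBasisIndex k (V i)) k (V i) := fun i => Free.chooseBasis k (V i)
  let B := Basis.piTensorProduct b
  haveI : ∀ i, Nonempty (Free.ChooseBasisIndex k (V i)) := fun i => (b i).index_nonempty
  obtain ⟨p⟩ : Nonempty (∀ i, Free.ChooseBasisIndex k (V i)) := inferInstance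
  exact ⟨⟨B p, 0, B.ne_zero p⟩⟩

/-- **Finite tensor products of irreducible representations with scalar commutant are
irreducible.** If each `ρ i` (`i ∈ ι`, finite) is irreducible and every intertwiner of `ρ i` is
scalar, then any representation `πS` of `∏ i, G i` on `⨂ i, V i` acting by `⊗ i, ρ i (g i)`
(characterising hypothesis `hπ`; Mathlib has no bundled outer tensor product of representations
of different groups) is irreducible.
(Bump 1997, Prop. 3.4.2 and Prop. 3.4.9, irreducibility part; cf. Flath 1979, Theorem 1.) [cite: Bump1997, Proposition 3.4.9] -/
theorem isIrreducible_of_forall_eq_piTensorProduct_map (ρ : ∀ i, Representation k (G i) (V i))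
    [∀ i, (ρ i).IsIrreducible]
    (hs : ∀ i (T : V i →ₗ[k] V i), (∀ g : G i, T ∘ₗ ρ i g = ρ i g ∘ₗ T) →
      ∃ c : k, T = c • LinearMap.id)
    (πS : Representation k (∀ i, G i) (⨂[k] i, V i))
    (hπ : ∀ g : ∀ i, G i, πS g = map fun i => ρ i (g i)) : πS.IsIrreducible := by
  haveI : ∀ i, Nontrivial (V i) := fun i => Representation.IsIrreducible.nontrivial (ρ i)
  haveI : Nontrivial (⨂[k] i, V i) := piTensorProduct_nontrivial
  refine { toNontrivial := ⟨⟨⊥, ⊤, fun hbt => ?_⟩⟩, eq_bot_or_eq_top := fun U => ?_ }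
  · exact bot_ne_top (congrArg Subrepresentation.toSubmodule hbt)
  · by_cases hU : U = ⊥
    · exact Or.inl hU
    refine Or.inr (Subrepresentation.toSubmodule_injective ?_)
    refine piTensorProduct_submodule_eq_top ρ
      (fun i => Representation.exists_asAlgebraHom_apply_eq (hs i)) (U := U.toSubmodule)
      (fun g u hu => ?_) fun h => hU (Subrepresentation.toSubmodule_injective h)
    rw [← hπ]
    exact U.apply_mem_toSubmodule g hu

/-- **Finite tensor products of irreducible admissible representations are irreducible**
(Flath's Theorem 1, irreducibility part): over an algebraically closed field, if each `ρ i` is an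
irreducible admissible representation of a topological group `G i` possessing a compact open
subgroup `K i`, then `∏ i, G i` acts irreducibly on `⨂ i, V i` by `⊗ i, ρ i (g i)`.
(Bump 1997, Prop. 3.4.9, irreducibility part, for finitely many factors; cf. Flath 1979,
Theorem 1.) [cite: Bump1997, Proposition 3.4.9] -/
theorem isIrreducible_of_forall_eq_piTensorProduct_map_of_isAdmissible [IsAlgClosed k]
    [∀ i, TopologicalSpace (G i)] [∀ i, SeparatelyContinuousMul (G i)]
    (ρ : ∀ i, Representation k (G i) (V i)) [∀ i, (ρ i).IsIrreducible]
    (hρ : ∀ i, (ρ i).IsAdmissible) {K : ∀ i, Subgroup (G i)}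
    (hK : ∀ i, IsOpen (K i : Set (G i))) (hKc : ∀ i, IsCompact (K i : Set (G i)))
    (πS : Representation k (∀ i, G i) (⨂[k] i, V i))
    (hπ : ∀ g : ∀ i, G i, πS g = map fun i => ρ i (g i)) : πS.IsIrreducible :=
  isIrreducible_of_forall_eq_piTensorProduct_map ρ
    (fun i T hT => (hρ i).exists_eq_smul_id (hK i) (hKc i) T hT) πS hπ

end PiTensor

/-! ### The structure maps of a restricted tensor product -/

section Range

variable {ι : Type u} {k : Type uk} [CommRing k] {V : ι → Type v} [∀ i, AddCommGroup (V i)]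
  [∀ i, Module k (V i)] {x₀ : ∀ i, V i} {W : Type w} [AddCommGroup W] [Module k W]
  [DecidableEq ι] {j : RestrictedFamily V x₀ → W}

/-- `S ↦ W_S = range (liftFinset S)` is monotone (the transition maps of the direct system
insert base vectors, `IsRestrictedMultilinear.range_liftFinset_mono`), so `W = ⋃_S W_S` is a
directed union. (Flath 1979, §2; Bump 1997, §3.3, definition of the restricted tensor product.)
[folklore] -/
theorem IsRestrictedMultilinear.monotone_range_liftFinset (hj : IsRestrictedMultilinear k j) :
    Monotone fun S : Finset ι => LinearMap.range (hj.liftFinset S) :=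
  fun _ _ hST => hj.range_liftFinset_mono hST

end Range

section Equivariance

variable {ι : Type u} {k : Type uk} [CommRing k] {G : ι → Type uG} [∀ i, Group (G i)]
  {K : ∀ i, Subgroup (G i)} {V : ι → Type v} [∀ i, AddCommGroup (V i)] [∀ i, Module k (V i)]
  {ρ : ∀ i, Representation k (G i) (V i)} {x₀ : ∀ i, V i} [DecidableEq ι]
  {W : Type w} [AddCommGroup W] [Module k W] {π : Representation k (Πʳ i, [G i, K i]) W}
  {hx₀ : ∀ᶠ i in cofinite, x₀ i ∈ (ρ i).fixedPoints (K i)}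
  {j : RestrictedFamily V x₀ → W}

/-- **Equivariance of the structure maps.** If `j` is equivariant, then for an element `g` of the
restricted product acting trivially on the base vectors off `S` (e.g. `g i = 1` off `S`), the
structure map `liftFinset S : ⨂_{i ∈ S} V i → W` intertwines `⊗_{i ∈ S} ρ i (g i)` with `π g`.
(Flath 1979, §2, Example 2; Bump 1997, §3.4.) [cite: FlathCorvallis1979, §2 Example 2] -/
theorem IsRestrictedMultilinear.liftFinset_map_eq (hj : IsRestrictedMultilinear k j)
    (hequiv : ∀ (g : Πʳ i, [G i, K i]) (x : RestrictedFamily V x₀),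
      j (RestrictedFamily.smul ρ hx₀ g x) = π g (j x))
    (S : Finset ι) (g : Πʳ i, [G i, K i]) (hg : ∀ i ∉ S, ρ i (g i) (x₀ i) = x₀ i)
    (t : ⨂[k] i : S, V i) :
    hj.liftFinset S (map (fun i : S => ρ i (g i)) t) = π g (hj.liftFinset S t) := by
  suffices hj.liftFinset S ∘ₗ map (fun i : S => ρ i (g i)) = π g ∘ₗ hj.liftFinset S from
    congr($this t)
  refine PiTensorProduct.ext (MultilinearMap.ext fun m => ?_)
  simp only [LinearMap.compMultilinearMap_apply, LinearMap.comp_apply, map_tprod,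
    IsRestrictedMultilinear.liftFinset_tprod]
  rw [← hequiv]
  congr 1
  ext i
  by_cases hi : i ∈ S
  · simp [RestrictedFamily.extend_apply_of_mem _ _ hi]
  · simp [RestrictedFamily.extend_apply_of_notMem _ _ hi, hg i hi]

end Equivariance

/-! ### Flath's theorem, easy direction -/

section Irreducible

variable {ι : Type u} {k : Type uk} [Field k] {G : ι → Type uG} [∀ i, Group (G i)]
  {K : ∀ i, Subgroup (G i)} {V : ι → Type v} [∀ i, AddCommGroup (V i)] [∀ i, Module k (V i)]
  {ρ : ∀ i, Representation k (G i) (V i)} {x₀ : ∀ i, V i} [DecidableEq ι]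
  {W : Type w} [AddCommGroup W] [Module k W] {π : Representation k (Πʳ i, [G i, K i]) W}
  {hx₀ : ∀ᶠ i in cofinite, x₀ i ∈ (ρ i).fixedPoints (K i)}
  {j : RestrictedFamily V x₀ → W} {S₀ : Finset ι} [∀ i, TopologicalSpace (G i)]

/-- **Flath's theorem (easy direction), discharging `IsRestrictedTensorProductRep.isIrreducible`.**
Over an algebraically closed field, a restricted tensor product `(W, π, j)` of irreducible
admissible representations `ρ i` of locally profinite groups `G i`, with respect to compact open
subgroups `K i`, is an irreducible representation of `Πʳ i, [G i, K i]`: `W` is the directed union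
of the `W_S = range (liftFinset S)`; by Schur (`Representation.IsAdmissible.exists_eq_smul_id`)
and Jacobson density (`Representation.exists_asAlgebraHom_apply_eq`) each `⨂_{i ∈ S} V i` is
irreducible under `∏_{i ∈ S} G i` (`piTensorProduct_submodule_eq_top`), and `liftFinset S` is
`∏_{i ∈ S} G i`-equivariant (`IsRestrictedMultilinear.liftFinset_map_eq`), so a non-zero
subrepresentation contains `W_S` for all large `S`. (The spherical hypothesis is not needed for
irreducibility, only for admissibility.)
(Flath 1979, Theorem 2 with Example 2; Bump 1997, Prop. 3.4.9 and Theorem 3.4.4.) [cite: FlathCorvallis1979, Theorem 2 / Example 2] -/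
theorem IsRestrictedTensorProductRep.isIrreducible_holds :
    IsRestrictedTensorProductRep.isIrreducible (ρ := ρ) (π := π) (hx₀ := hx₀) (j := j)
      (S₀ := S₀) := by
  intro _ _ _ _ hK hKc hirr hρ _ h
  obtain ⟨hj, hinj, hsup⟩ := h.isRestrictedTensorProduct
  have hequiv := h.map_smul
  -- Jacobson density for each (irreducible, admissible ⇒ scalar commutant) factor
  have hd : ∀ (i : ι) (s : Finset (V i)) (f : V i →ₗ[k] V i),
      ∃ r : MonoidAlgebra k (G i), ∀ m ∈ s, (ρ i).asAlgebraHom r m = f m := fun i =>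
    haveI := hirr i
    Representation.exists_asAlgebraHom_apply_eq
      fun T hT => (hρ i).exists_eq_smul_id (hK i) (hKc i) T hT
  haveI hVnt : ∀ i, Nontrivial (V i) := fun i =>
    haveI := hirr i
    Representation.IsIrreducible.nontrivial (ρ i)
  -- `W ≠ 0`: `liftFinset S₀` is injective on the non-zero `⨂_{i ∈ S₀} V i`
  haveI : Nontrivial W :=
    haveI : Nontrivial (⨂[k] i : S₀, V i) := piTensorProduct_nontrivial
    (hinj S₀ subset_rfl).nontrivial
  have hmono : Monotone fun S : Finset ι => LinearMap.range (hj.liftFinset S) :=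
    hj.monotone_range_liftFinset
  have hmem : ∀ w : W, ∃ S : Finset ι, w ∈ LinearMap.range (hj.liftFinset S) := fun w =>
    (Submodule.mem_iSup_of_directed _ hmono.directed_le).1 (by rw [hsup]; exact Submodule.mem_top)
  refine { toNontrivial := ⟨⟨⊥, ⊤, fun hbt => ?_⟩⟩, eq_bot_or_eq_top := fun U => ?_ }
  · exact bot_ne_top (congrArg Subrepresentation.toSubmodule hbt)
  by_cases hU : U = ⊥
  · exact Or.inl hU
  refine Or.inr (Subrepresentation.toSubmodule_injective (Submodule.eq_top_iff'.2 fun w => ?_))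
  have hU' : U.toSubmodule ≠ ⊥ := fun h' => hU (Subrepresentation.toSubmodule_injective h')
  obtain ⟨u, huU, hu0⟩ := Submodule.exists_mem_ne_zero_of_ne_bot hU'
  obtain ⟨S₁, hu⟩ := hmem u
  obtain ⟨S₂, hw⟩ := hmem w
  obtain ⟨S, hS₁, hS₂⟩ : ∃ S : Finset ι, S₁ ⊆ S ∧ S₂ ⊆ S :=
    ⟨S₁ ∪ S₂, Finset.subset_union_left, Finset.subset_union_right⟩
  obtain ⟨t₀, rfl⟩ : u ∈ LinearMap.range (hj.liftFinset S) := hmono hS₁ hu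
  obtain ⟨t₁, rfl⟩ : w ∈ LinearMap.range (hj.liftFinset S) := hmono hS₂ hw
  -- the preimage of `U` in `⨂_{i ∈ S} V i` is stable under `∏_{i ∈ S} G i` and non-zero
  let U' : Submodule k (⨂[k] i : S, V i) := U.toSubmodule.comap (hj.liftFinset S)
  have hstab : ∀ (g : ∀ i : S, G i), ∀ t ∈ U', map (fun i : S => ρ i (g i)) t ∈ U' := by
    intro g t ht
    let g' : Πʳ i, [G i, K i] :=
      RestrictedProduct.mk (fun i => if hi : i ∈ S then g ⟨i, hi⟩ else 1)
        (S.eventually_cofinite_notMem.mono fun i hi => by simp [hi])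
    have hg' : (fun i : S => ρ i (g i)) = fun i : S => ρ i (g' i) := by
      funext i
      change ρ i (g i) = ρ i (if hi : (i : ι) ∈ S then g ⟨i, hi⟩ else 1)
      rw [dif_pos i.2]
    have hg'' : ∀ i ∉ S, ρ i (g' i) (x₀ i) = x₀ i := fun i hi => by
      change ρ i (if hi : (i : ι) ∈ S then g ⟨i, hi⟩ else 1) (x₀ i) = x₀ i
      rw [dif_neg hi, map_one, Module.End.one_apply]
    change hj.liftFinset S (map (fun i : S => ρ i (g i)) t) ∈ U.toSubmodule
    rw [hg', hj.liftFinset_map_eq hequiv S g' hg'' t]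
    exact U.apply_mem_toSubmodule g' ht
  have hU'0 : U' ≠ ⊥ := by
    intro hbot
    have ht₀ : t₀ ∈ U' := huU
    rw [hbot, Submodule.mem_bot] at ht₀
    exact hu0 (by rw [ht₀, map_zero])
  have hU'top : U' = ⊤ :=
    piTensorProduct_submodule_eq_top (fun i : S => ρ i) (fun i => hd i) hstab hU'0
  have ht₁ : t₁ ∈ U' := hU'top ▸ Submodule.mem_top
  exact ht₁

end Irreducible

end Literature.NumberTheory.Automorphic
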